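import Literature.Geometry.Lorentzian.AFEndBreathingData
import Literature.Geometry.Manifold.BilinFamilyPullback
import Literature.Geometry.Manifold.BilinFamilySectionPullback
import HarnessLib

/-!
# The breathing deformation of a smooth FAMILY of initial data sets is jointly smooth

Sequel to `AFEndBreathingData.lean` (topic `Geometry/Lorentzian`; everything PROVED, no definitions,
no named facts). There, for ONE initial data set `d` on a `3`-manifold `X` with an asymptotically flat
end `e` and breathing data `B : e.BreathingData z₀ r`, the breathing family
`t ↦ E_t(d) = (breathe (σ t))^* d` was shown jointly smooth in `(t, x)`
(`contMDiff_breatheFamily_h/k`). Here the datum itself varies in a jointly smooth family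
`G : P' → data` (the `h`/`k`-halves of `InitialDataSet.IsSmoothDataFamily`) and the breathing parameter is
read off through smooth maps `pr : Q → P'`, `τ : Q → ℝ` of a parameter space `Q`:

* `hCoeff_eq_pullbackBilin_dataChartExt`, `kCoeff_eq_pullbackBilin_dataChartExt` — on the exterior
  region the chart components are the pullbacks along the TOTAL inverse chart `dataChartExt : ℝ³ → X`;
* `contDiffAt_hCoeff_family`, `contDiffAt_kCoeff_family` — **the chart components of a jointly smooth
  family of data are jointly smooth** in (parameter, point) on the exterior region (read the family
  through the fixed immersion `dataChartExt`, `contDiffAt_pullbackBilin_familySection`);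
* `contMDiffAt_breatheCoeff_family` — parametric version of `contMDiffAt_breatheCoeff`;
* `contMDiff_pullbackBilin_breathe_family_param` — parametric version of
  `contMDiff_pullbackBilin_breathe_family`: `(q, x) ↦ (Φ_{σ(τ q)})^* (b (pr q))` is jointly smooth;
* `contMDiff_breatheFamily_family_h`, `contMDiff_breatheFamily_family_k` — **the family
  `q ↦ E_{τ q}(G (pr q))` has jointly smooth metric and second fundamental form**, i.e. it is again an
  `IsSmoothDataFamily`-shaped family.

Use: the gauge-enrichment / injectivity device for MANY-parameter probes of admissible data (item
`RobustClausewiseGenericity.GaugeEnrichment` of summit `FinalStateConjecture`: every tame `m`-parameter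
probe enriches by the breathing parameter). Standard differential topology (Lee 2013, Ch. 2,
Prop. 2.25) and the diffeomorphism equivariance of initial data (Bartnik–Isenberg 2004, §2).

## References

* J. M. Lee, *Introduction to Smooth Manifolds*, 2nd ed. (2013), Ch. 2, Prop. 2.25. [LeeSmoothManifolds2013]
* R. Bartnik, J. Isenberg, *The constraint equations* (2004), §2. [BartnikIsenberg2004]
* R. Bartnik, *The mass of an asymptotically flat manifold*, CPAM 39 (1986), §1, (1.3). [Bartnik1986]
-/

noncomputable section

open Bundle Set Function Filter TopologicalSpace Metric
open scoped Manifold ContDiff Topology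

namespace Literature.Geometry.Lorentzian

namespace AFEnd

open Literature.Geometry.Manifold

variable {X : Type} [TopologicalSpace X] [ChartedSpace E3 X] [IsManifold (𝓡 3) ∞ X]
  {e : AFEnd X} {P' : Type*} [NormedAddCommGroup P'] [NormedSpace ℝ P']

/-! ### Chart components of a smooth family of data are jointly smooth -/

/-- On the exterior region the chart components of `h` are the pullback along `dataChartExt` (as a
map from all of `ℝ³`) of the metric. [cite: Bartnik1986, (1.3)] -/
theorem hCoeff_eq_pullbackBilin_dataChartExt (D : InitialDataSet (𝓡 3) X) {z : E3} (hz : e.R < ‖z‖) :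
    hCoeff e D z = (show E3 →L[ℝ] E3 →L[ℝ] ℝ from
      pullbackBilin (I := 𝓡 3) (I' := 𝓘(ℝ, E3)) e.dataChartExt D.h.inner z) := by
  ext v w
  rw [e.hCoeff_apply_eq_dataChartExt D hz]
  rfl

/-- On the exterior region the chart components of `k` are the pullback along `dataChartExt` of
`k`. [cite: ChristodoulouKlainerman1993, (1.0.9)] -/
theorem kCoeff_eq_pullbackBilin_dataChartExt (D : InitialDataSet (𝓡 3) X) {z : E3} (hz : e.R < ‖z‖) :
    kCoeff e D z = (show E3 →L[ℝ] E3 →L[ℝ] ℝ from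
      pullbackBilin (I := 𝓡 3) (I' := 𝓘(ℝ, E3)) e.dataChartExt D.k z) := by
  ext v w
  rw [e.kCoeff_apply_eq_dataChartExt D hz]
  rfl

omit [IsManifold (𝓡 3) ∞ X] in
/-- `dataChartExt` is `C^{∞+1}` at points of the exterior region. [folklore] -/
theorem contMDiffAt_dataChartExt_succ {z : E3} (hz : e.R < ‖z‖) :
    ContMDiffAt 𝓘(ℝ, E3) (𝓡 3) (∞ + 1) e.dataChartExt z := by
  have h : ((∞ : ℕ∞ω) + 1) = ∞ := rfl
  rw [h]
  exact e.contMDiffAt_dataChartExt hz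

/-- **The chart components of `h` of a jointly smooth family of data are jointly smooth** in
(parameter, point) on the exterior region: `(p, z) ↦ hCoeff e (G p) z` is `C^∞` at `(p, z)` for
`R < ‖z‖` whenever `(p, x) ↦ (x, h_{G p}(x))` is `C^∞` into `Hom(TX, Hom(TX, ℝ))` (read the family
through the fixed immersion `dataChartExt`). [cite: Bartnik1986, (1.3)] -/
theorem contDiffAt_hCoeff_family {G : P' → InitialDataSet (𝓡 3) X}
    (hG : ContMDiff (𝓘(ℝ, P').prod (𝓡 3)) ((𝓡 3).prod 𝓘(ℝ, E3 →L[ℝ] E3 →L[ℝ] ℝ)) ∞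
      (fun q : P' × X ↦ TotalSpace.mk' (E3 →L[ℝ] E3 →L[ℝ] ℝ)
        (E := fun x : X ↦ TangentSpace (𝓡 3) x →L[ℝ] TangentSpace (𝓡 3) x →L[ℝ] ℝ) q.2
        ((G q.1).h.inner q.2)))
    (p : P') {z : E3} (hz : e.R < ‖z‖) :
    ContDiffAt ℝ ∞ (uncurry fun (p : P') (z : E3) ↦ hCoeff e (G p) z) (p, z) := by
  have h := contDiffAt_pullbackBilin_familySection (I := 𝓡 3) (n := ∞) (p₀ := p)
    (s := fun p x ↦ (G p).h.inner x) (e.contMDiffAt_dataChartExt_succ hz) (hG (p, e.dataChartExt z))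
  refine h.congr_of_eventuallyEq ?_
  have hev : ∀ᶠ q : P' × E3 in 𝓝 (p, z), e.R < ‖q.2‖ :=
    (continuousAt_snd (p := (p, z))).eventually
      ((isOpen_lt continuous_const continuous_norm).mem_nhds hz)
  filter_upwards [hev] with q hq
  exact hCoeff_eq_pullbackBilin_dataChartExt (G q.1) hq

/-- **The chart components of `k` of a jointly smooth family of data are jointly smooth** on the
exterior region. [cite: ChristodoulouKlainerman1993, (1.0.9)] -/
theorem contDiffAt_kCoeff_family {G : P' → InitialDataSet (𝓡 3) X}
    (hG : ContMDiff (𝓘(ℝ, P').prod (𝓡 3)) ((𝓡 3).prod 𝓘(ℝ, E3 →L[ℝ] E3 →L[ℝ] ℝ)) ∞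
      (fun q : P' × X ↦ TotalSpace.mk' (E3 →L[ℝ] E3 →L[ℝ] ℝ)
        (E := fun x : X ↦ TangentSpace (𝓡 3) x →L[ℝ] TangentSpace (𝓡 3) x →L[ℝ] ℝ) q.2
        ((G q.1).k q.2)))
    (p : P') {z : E3} (hz : e.R < ‖z‖) :
    ContDiffAt ℝ ∞ (uncurry fun (p : P') (z : E3) ↦ kCoeff e (G p) z) (p, z) := by
  have h := contDiffAt_pullbackBilin_familySection (I := 𝓡 3) (n := ∞) (p₀ := p)
    (s := fun p x ↦ (G p).k x) (e.contMDiffAt_dataChartExt_succ hz) (hG (p, e.dataChartExt z))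
  refine h.congr_of_eventuallyEq ?_
  have hev : ∀ᶠ q : P' × E3 in 𝓝 (p, z), e.R < ‖q.2‖ :=
    (continuousAt_snd (p := (p, z))).eventually
      ((isOpen_lt continuous_const continuous_norm).mem_nhds hz)
  filter_upwards [hev] with q hq
  exact kCoeff_eq_pullbackBilin_dataChartExt (G q.1) hq

/-! ### The breathing family of a smooth family of data is jointly smooth -/

variable [T2Space X] {z₀ : E3} {r : ℝ} (B : BreathingData e z₀ r)

-- the operator norm on `E3 →L[ℝ] E3 →L[ℝ] ℝ` is slow to synthesize through `PiLp`
set_option synthInstance.maxHeartbeats 100000 in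
omit [IsManifold (𝓡 3) ∞ X] [T2Space X] in
/-- **Parametric `breatheCoeff`**: `(q, z) ↦ breatheCoeff (H (pr q)) (τ q) z` is smooth at `(q₀, z₁)`
when `(p, z) ↦ H p z` is smooth at `(pr q₀, φ_{τ q₀} z₁)`, `pr` and `τ` smooth (calculus: `H ∘ (pr, φ)`,
the parametric derivative `(q, z) ↦ dφ_{τ q}(z)` and composition of continuous linear maps). [folklore] -/
theorem contMDiffAt_breatheCoeff_family {Q : Type*} [NormedAddCommGroup Q] [NormedSpace ℝ Q]
    (z₀ : E3) (r : ℝ) {H : P' → E3 → E3 →L[ℝ] E3 →L[ℝ] ℝ} {pr : Q → P'} (hpr : ContDiff ℝ ∞ pr)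
    {τ : Q → ℝ} (hτ : ContDiff ℝ ∞ τ) {q₀ : Q} {z₁ : E3}
    (hH : ContDiffAt ℝ ∞ (uncurry H) (pr q₀, Breathing.phi z₀ r (τ q₀) z₁)) :
    ContMDiffAt (𝓘(ℝ, Q).prod 𝓘(ℝ, E3)) 𝓘(ℝ, E3 →L[ℝ] E3 →L[ℝ] ℝ) ∞
      (fun q : Q × E3 ↦ breatheCoeff z₀ r (H (pr q.1)) (τ q.1) q.2) (q₀, z₁) := by
  -- `(q, z) ↦ φ (τ q.1) z` is smooth jointly in `(q, z)`, so `q ↦ dφ_{τ q.1}(q.2)` is smooth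
  have hφ2 : ContDiff ℝ ∞ (uncurry fun (q : Q × E3) (z : E3) ↦ Breathing.phi z₀ r (τ q.1) z) :=
    (Breathing.contDiff_uncurry_phi z₀ r (n := ⊤)).comp
      ((hτ.comp (contDiff_fst.comp contDiff_fst)).prodMk contDiff_snd)
  have hA : ContDiff ℝ ∞ (fun q : Q × E3 ↦ fderiv ℝ (Breathing.phi z₀ r (τ q.1)) q.2) :=
    hφ2.fderiv contDiff_snd le_rfl
  have hφ1 : ContDiff ℝ ∞ (fun q : Q × E3 ↦ Breathing.phi z₀ r (τ q.1) q.2) :=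
    (Breathing.contDiff_uncurry_phi z₀ r (n := ⊤)).comp ((hτ.comp contDiff_fst).prodMk contDiff_snd)
  have hprφ : ContDiff ℝ ∞ (fun q : Q × E3 ↦ (pr q.1, Breathing.phi z₀ r (τ q.1) q.2)) :=
    (hpr.comp contDiff_fst).prodMk hφ1
  have hHφ : ContDiffAt ℝ ∞ (fun q : Q × E3 ↦ H (pr q.1) (Breathing.phi z₀ r (τ q.1) q.2)) (q₀, z₁) :=
    ContDiffAt.comp (q₀, z₁) (g := uncurry H) hH hprφ.contDiffAt
  -- pass to the product manifold `Q × ℝ³`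
  have hid : ContMDiffAt (𝓘(ℝ, Q).prod 𝓘(ℝ, E3)) 𝓘(ℝ, Q × E3) ∞ (fun q : Q × E3 ↦ (q.1, q.2)) (q₀, z₁) :=
    contMDiffAt_fst.prodMk_space contMDiffAt_snd
  have hA' : ContMDiffAt (𝓘(ℝ, Q).prod 𝓘(ℝ, E3)) 𝓘(ℝ, E3 →L[ℝ] E3) ∞
      (fun q : Q × E3 ↦ fderiv ℝ (Breathing.phi z₀ r (τ q.1)) q.2) (q₀, z₁) :=
    hA.contDiffAt.comp_contMDiffAt hid
  have hHφ' : ContMDiffAt (𝓘(ℝ, Q).prod 𝓘(ℝ, E3)) 𝓘(ℝ, E3 →L[ℝ] E3 →L[ℝ] ℝ) ∞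
      (fun q : Q × E3 ↦ H (pr q.1) (Breathing.phi z₀ r (τ q.1) q.2)) (q₀, z₁) :=
    ContDiffAt.comp_contMDiffAt (g := fun q : Q × E3 ↦ H (pr q.1) (Breathing.phi z₀ r (τ q.1) q.2))
      (f := fun q : Q × E3 ↦ (q.1, q.2)) (x := (q₀, z₁)) hHφ hid
  exact (hA'.clm_precomp (F₃ := ℝ)).clm_comp (hHφ'.clm_comp hA')

/-- **Joint smoothness of `(q, x) ↦ (Φ_{σ (τ q)})^* (b (pr q))`** for a smooth FAMILY `b` of sections
which on the end are `coord^* (H p)` with `(p, z) ↦ H p z` smooth on the exterior region — the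
parametric form of `contMDiff_pullbackBilin_breathe_family` (there `b`, `H` constant in the
parameter). Off the moved set the family is `b (pr q)` near `x`; on the carrier it is the pullback
along `coord` of the smooth family `breatheCoeff (H (pr q)) (σ (τ q))` of fields on `ℝ³`
(`contMDiffAt_pullbackBilin_family`). [cite: LeeSmoothManifolds2013, Prop. 2.25] -/
theorem contMDiff_pullbackBilin_breathe_family_param {Q : Type*} [NormedAddCommGroup Q] [NormedSpace ℝ Q]
    {pr : Q → P'} (hpr : ContDiff ℝ ∞ pr) {τ : Q → ℝ} (hτ : ContDiff ℝ ∞ τ)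
    {b : P' → Π y : X, TangentSpace (𝓡 3) y →L[ℝ] TangentSpace (𝓡 3) y →L[ℝ] ℝ}
    {H : P' → E3 → E3 →L[ℝ] E3 →L[ℝ] ℝ}
    (hbs : ContMDiff (𝓘(ℝ, P').prod (𝓡 3)) ((𝓡 3).prod 𝓘(ℝ, E3 →L[ℝ] E3 →L[ℝ] ℝ)) ∞
      (fun q : P' × X ↦ TotalSpace.mk' (E3 →L[ℝ] E3 →L[ℝ] ℝ)
        (E := fun x : X ↦ TangentSpace (𝓡 3) x →L[ℝ] TangentSpace (𝓡 3) x →L[ℝ] ℝ) q.2 (b q.1 q.2)))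
    (hb : ∀ p, ∀ y ∈ e.U, b p y = pullbackBilin (I := 𝓘(ℝ, E3)) (I' := 𝓡 3) e.coord
      (show Π z : E3, TangentSpace 𝓘(ℝ, E3) z →L[ℝ] TangentSpace 𝓘(ℝ, E3) z →L[ℝ] ℝ from H p) y)
    (hH : ∀ (p : P') (z : E3), e.R < ‖z‖ → ContDiffAt ℝ ∞ (uncurry H) (p, z)) :
    ContMDiff (𝓘(ℝ, Q).prod (𝓡 3)) ((𝓡 3).prod 𝓘(ℝ, E3 →L[ℝ] E3 →L[ℝ] ℝ)) ∞
      (fun q : Q × X ↦ TotalSpace.mk' (E3 →L[ℝ] E3 →L[ℝ] ℝ)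
        (E := fun x : X ↦ TangentSpace (𝓡 3) x →L[ℝ] TangentSpace (𝓡 3) x →L[ℝ] ℝ) q.2
        (pullbackBilin (I := 𝓡 3) (I' := 𝓡 3) (e.breathe z₀ r (squash B (τ q.1))) (b (pr q.1)) q.2)) := by
  rintro ⟨q, x⟩
  have hστ : ContDiff ℝ ∞ (fun q : Q ↦ squash B (τ q)) := (contDiff_squash B (n := ⊤)).comp hτ
  by_cases hx : x ∈ e.breatheCarrier z₀ r
  · -- on the carrier: pullback along `coord` of a smooth family of fields on `ℝ³`
    have hz : e.R < ‖Breathing.phi z₀ r (squash B (τ q)) (e.coord x)‖ :=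
      B.R_lt_norm_phi (abs_squash_lt_scale B (τ q)).2 hx.2
    have hc' : ContMDiffAt (𝓘(ℝ, Q).prod 𝓘(ℝ, E3)) 𝓘(ℝ, E3 →L[ℝ] E3 →L[ℝ] ℝ) ∞
        (fun q : Q × E3 ↦ breatheCoeff z₀ r (H (pr q.1)) (squash B (τ q.1)) q.2) (q, e.coord x) :=
      contMDiffAt_breatheCoeff_family z₀ r hpr hστ (hH _ _ hz)
    have hmain := contMDiffAt_pullbackBilin_family (IP := 𝓘(ℝ, Q)) (I' := 𝓡 3) (n := ∞) (p₀ := q)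
      (c := fun (q : Q) (z : E3) ↦ breatheCoeff z₀ r (H (pr q)) (squash B (τ q)) z)
      (e.contMDiffAt_coord hx.1) hc'
    refine hmain.congr_of_eventuallyEq ?_
    have hev : ∀ᶠ q : Q × X in 𝓝 (q, x), q.2 ∈ e.breatheCarrier z₀ r :=
      (continuousAt_snd (p := (q, x))).preimage_mem_nhds ((e.isOpen_breatheCarrier z₀ r).mem_nhds hx)
    filter_upwards [hev] with q hq
    rw [pullbackBilin_breathe_eq_of_mem_carrier B (τ q.1) hq (hb (pr q.1))]
  · -- off the carrier (hence off the moved set): locally the family `b (pr q)`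
    have hK : x ∉ breatheCore e z₀ r := fun h ↦ hx (breatheCore_subset_carrier B h)
    have hpr' : ContMDiffAt (𝓘(ℝ, Q).prod (𝓡 3)) (𝓘(ℝ, P').prod (𝓡 3)) ∞
        (fun p : Q × X ↦ (pr p.1, p.2)) (q, x) :=
      ((contMDiffAt_iff_contDiffAt.2 hpr.contDiffAt).comp (q, x) contMDiffAt_fst).prodMk contMDiffAt_snd
    have hconst : ContMDiffAt (𝓘(ℝ, Q).prod (𝓡 3)) ((𝓡 3).prod 𝓘(ℝ, E3 →L[ℝ] E3 →L[ℝ] ℝ)) ∞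
        (fun p : Q × X ↦ TotalSpace.mk' (E3 →L[ℝ] E3 →L[ℝ] ℝ)
          (E := fun x : X ↦ TangentSpace (𝓡 3) x →L[ℝ] TangentSpace (𝓡 3) x →L[ℝ] ℝ) p.2 (b (pr p.1) p.2))
        (q, x) :=
      (hbs (pr q, x)).comp (q, x) hpr'
    refine hconst.congr_of_eventuallyEq ?_
    have hev : ∀ᶠ p : Q × X in 𝓝 (q, x), p.2 ∉ breatheCore e z₀ r :=
      (continuousAt_snd (p := (q, x))).preimage_mem_nhds
        ((isCompact_breatheCore B).isClosed.isOpen_compl.mem_nhds hK)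
    filter_upwards [hev] with p hp
    have hid := mfderiv_breathe_of_not_mem_core B (s := squash B (τ p.1)) hp
    have hpt := breathe_eq_self_of_not_mem_core B (s := squash B (τ p.1)) hp
    have key : ∀ (p' : X) (_ : p' = p.2) (L : TangentSpace (𝓡 3) p.2 →L[ℝ] TangentSpace (𝓡 3) p')
        (_ : ∀ v, HEq (L v) v) (v w : TangentSpace (𝓡 3) p.2), b (pr p.1) p' (L v) (L w) = b (pr p.1) p.2 v w := by
      rintro p' rfl L hL v w
      rw [eq_of_heq (hL v), eq_of_heq (hL w)]
    have hL : ∀ v : TangentSpace (𝓡 3) p.2,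
        HEq (mfderiv (𝓡 3) (𝓡 3) (e.breathe z₀ r (squash B (τ p.1))) p.2 v) v := fun v ↦ by
      rw [hid]
      rfl
    congr 1
    ext v w
    rw [pullbackBilin_apply]
    exact key _ hpt _ hL v w

/-- **The metric of the breathing family of a smooth FAMILY of data is jointly smooth**: for a
family `G : P' → data` whose metrics are jointly smooth in `(p, x)` (the `h`-half of
`InitialDataSet.IsSmoothDataFamily`) and smooth parameter maps `pr : Q → P'`, `τ : Q → ℝ`, the
family `q ↦ E_{τ q}(G (pr q)) = (breathe (σ (τ q)))^* (G (pr q))` has jointly smooth metrics.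
[cite: LeeSmoothManifolds2013, Prop. 2.25] -/
theorem contMDiff_breatheFamily_family_h {Q : Type*} [NormedAddCommGroup Q] [NormedSpace ℝ Q]
    {pr : Q → P'} (hpr : ContDiff ℝ ∞ pr) {τ : Q → ℝ} (hτ : ContDiff ℝ ∞ τ)
    {G : P' → InitialDataSet (𝓡 3) X}
    (hG : ContMDiff (𝓘(ℝ, P').prod (𝓡 3)) ((𝓡 3).prod 𝓘(ℝ, E3 →L[ℝ] E3 →L[ℝ] ℝ)) ∞
      (fun q : P' × X ↦ TotalSpace.mk' (E3 →L[ℝ] E3 →L[ℝ] ℝ)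
        (E := fun x : X ↦ TangentSpace (𝓡 3) x →L[ℝ] TangentSpace (𝓡 3) x →L[ℝ] ℝ) q.2
        ((G q.1).h.inner q.2))) :
    ContMDiff (𝓘(ℝ, Q).prod (𝓡 3)) ((𝓡 3).prod 𝓘(ℝ, E3 →L[ℝ] E3 →L[ℝ] ℝ)) ∞
      (fun q : Q × X ↦ TotalSpace.mk' (E3 →L[ℝ] E3 →L[ℝ] ℝ)
        (E := fun x : X ↦ TangentSpace (𝓡 3) x →L[ℝ] TangentSpace (𝓡 3) x →L[ℝ] ℝ) q.2
        ((breatheFamily B (G (pr q.1)) (τ q.1)).h.inner q.2)) :=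
  contMDiff_pullbackBilin_breathe_family_param B hpr hτ (b := fun p ↦ (G p).h.inner)
    (H := fun p ↦ hCoeff e (G p)) hG (fun p _ hy ↦ h_inner_eq_pullbackBilin_coord (G p) hy)
    (fun p _ hz ↦ contDiffAt_hCoeff_family hG p hz)

/-- **The tensor `k` of the breathing family of a smooth FAMILY of data is jointly smooth.**
[cite: LeeSmoothManifolds2013, Prop. 2.25] -/
theorem contMDiff_breatheFamily_family_k {Q : Type*} [NormedAddCommGroup Q] [NormedSpace ℝ Q]
    {pr : Q → P'} (hpr : ContDiff ℝ ∞ pr) {τ : Q → ℝ} (hτ : ContDiff ℝ ∞ τ)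
    {G : P' → InitialDataSet (𝓡 3) X}
    (hG : ContMDiff (𝓘(ℝ, P').prod (𝓡 3)) ((𝓡 3).prod 𝓘(ℝ, E3 →L[ℝ] E3 →L[ℝ] ℝ)) ∞
      (fun q : P' × X ↦ TotalSpace.mk' (E3 →L[ℝ] E3 →L[ℝ] ℝ)
        (E := fun x : X ↦ TangentSpace (𝓡 3) x →L[ℝ] TangentSpace (𝓡 3) x →L[ℝ] ℝ) q.2
        ((G q.1).k q.2))) :
    ContMDiff (𝓘(ℝ, Q).prod (𝓡 3)) ((𝓡 3).prod 𝓘(ℝ, E3 →L[ℝ] E3 →L[ℝ] ℝ)) ∞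
      (fun q : Q × X ↦ TotalSpace.mk' (E3 →L[ℝ] E3 →L[ℝ] ℝ)
        (E := fun x : X ↦ TangentSpace (𝓡 3) x →L[ℝ] TangentSpace (𝓡 3) x →L[ℝ] ℝ) q.2
        ((breatheFamily B (G (pr q.1)) (τ q.1)).k q.2)) :=
  contMDiff_pullbackBilin_breathe_family_param B hpr hτ (b := fun p ↦ (G p).k)
    (H := fun p ↦ kCoeff e (G p)) hG (fun p _ hy ↦ k_eq_pullbackBilin_coord (G p) hy)
    (fun p _ hz ↦ contDiffAt_kCoeff_family hG p hz)

end AFEnd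

end Literature.Geometry.Lorentzian

end
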